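import Literature.MathematicalPhysics.QuantumFieldTheory.Balaban1983to89.B4Lemma22BoxNoCollar
import Literature.MathematicalPhysics.QuantumFieldTheory.Balaban1983to89.B4Lemma22Invertible

/-!
# `Balaban1983to89.B4Lemma22NoCollarContours` — [Balaban1983RegularityDecay] LEMMA 2.2 (2.17) (sup members) and (2.20) for
# `G_k(□, A)` at a (1.7)-REGULAR `A` WITH NO COLLAR, FOR A GENERAL CONTOUR SYSTEM `Γ^{(k)}_{y,x}` of the averaging (1.4)
# (r04's `B4Lemma22BoxNoCollar.lemma22_sup_noCollar` / `eq220_noCollar` are the case of the lineage's single staircase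
# `stairContour`; the (Higgs)₂,₃ model of [Balaban1982Higgs1] uses the COMPOSITE contour (2.2) «Γ^{(k)}_{y,x} = Γ_{y,x_{k−1}} ∪ … ∪ Γ_{x₁,x}»)

statement-level skeleton of published theorems with citation tags; proofs where landed; nothing here is a claim about the Yang–Mills mass gap

CITATION HEADER (lean-in-tree rule).  T. Bałaban, *Regularity and decay of lattice Green's functions*, Commun. Math. Phys. **89** (1983)
571–597, doi:10.1007/bf01214744 [Balaban1983RegularityDecay] (cell paper B4; held text `paper:balaban1983-cmp89-regularity-decay`,
journal page = PDF page + 570; p. 572 (1.4)–(1.7), p. 575 «Ã_j = A», p. 578 Lemma 2.2 (2.17)/(2.20), p. 579 «we can apply Lemma 2.2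
to all operators in it», p. 581), and T. Bałaban, *(Higgs)₂,₃ quantum fields in a finite volume. I*, Commun. Math. Phys. **85** (1982)
603–626 [Balaban1982Higgs1] ((2.2) p. 608 the composite contour).  Cell `lit-balaban` (HOME `run/shared/lean/pub/lit-balaban/`), Phase-2
proof seat **p35** gen 15 (unit `lit-balaban-p35`); SKELETON rows **B4.Lem2.2** / **B4.Eq2.18** ((2.17) sup members and (2.20) at the raw
regular field, generic contour system — the form consumed by the (Higgs)₂,₃ carrier through the sub-box chart `B1TorusSubBoxOp`) and
**B1.Prop2.1** (parallelepiped clause).  USED BY NAME, never restated: r04 g15 `B4Lemma22BoxNoCollar.{lemma22_17_sup_box_face (GENERIC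
contour system), gSig, gBond, bondGauge_gBond, gBond_hyps, noCollar_threshold}`, r01's `B4Lemma22Invertible.opA_isUnit_det` (invertibility
for ANY contour system with `hnn`/`hend`), `B4Lower18Regular.abs_lsum_le`, `B4GaugeCovariance.b4Green_bondGauge`,
`B4Lemma22ReduceZero.{sup_hyps_conj, covDeriv_gauge}`, `B4CubeFieldHyps22.{greenA_smul, derivA_smul, aSeq_window}`, p35 gen 8's
`B4Eq220CommutatorField.{eq220_field_reduction_sup, sizes_Minv_field, supN_mulH_le}`, `B4Eq220PartitionSizes.{hBox, hsize_hBox}`,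
`B4BoxNeumannGauge.{C1, C2}`.

WHAT IS PRINTED.  p. 572 (1.4): *«(Q_k(A)φ)(y) = Σ_{x∈B^k(y)} η^d U(A(Γ^{(k)}_{y,x}))φ(x)»* — the contour `Γ^{(k)}_{y,x}` is the one «described
in» [Balaban1982Higgs1] (2.2); p. 575 [PDF 5] L22–24, verbatim: *«where the configurations Ã_j are constructed in the following way:
if □_j intersects the boundary of Ω, then Ã_j = A; if □_j is an interior cube of Ω, then we take Ã_j as equal to A on the cube
{x : |x − Mj| ≦ (3/4)M}, and changing regularly to a constant function in a neighbourhood of a boundary of □_j.»*; p. 579 [PDF 9]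
L25–28, verbatim: *«Finally let us notice that if Ω is a rectangular parallelepiped, then all □_j in the representation (2.13) are
cubes and we can apply Lemma 2.2 to all operators in it, so the restriction dist({x, x′}, Ωᶜ) ≧ R₀ is unnecessary.»*  Lemma 2.2
(2.17)/(2.20) p. 578 are quoted in `B4Lemma22BoxNoCollar`.  (v1.1, p35 gen 17, docstrings only: the p. 575 Ã_j sentence re-set verbatim
from the text layer `p0005.txt` L22–24 and the render `1983-cmp89-regularity-decay-p005-x2.png` — v1.0 carried a paraphrase inside
guillemets, ref-4 S-B1-g54-1 (b); the locator of (1.7) corrected to p. 572 — (1.4)–(1.7) are displays of p. 572 [PDF 2], r04 g22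
CITELOC-AUDIT-g22 §3; no declaration changed.)

WHY THIS FILE.  r04's no-collar Lemma 2.2 is assembled for the staircase contour system `B4Lower18Regular.stairContour` (one staircase
from the block corner `n·y` to `x`); the (Higgs)₂,₃ carrier's `P_k(A) = Q_k^*(A)Q_k(A)` ([Balaban1982Higgs1] (2.11)/(2.20)) transports along
the COMPOSITE contour (2.2), which for `k ≥ 2` is a different nearest-neighbour path (p35 gen 8 `B1TorusCubeContours.mlist`).  r04's
generic lemma `lemma22_17_sup_box_face` takes the contour system as a parameter with the hypotheses «ends at `x`», «invertible» and a
bound `τ` on `|κA′(Γ)|`; this file discharges them for ANY nearest-neighbour system of length `≤ (d+1)·n` starting at the block corner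
(invertibility by r01's `opA_isUnit_det`, `τ = (d+1)θ` by `abs_lsum_le`) and repeats r04's gauge step and (2.20) reduction verbatim.

WHAT THIS MODULE PROVES (theorems only; no `def`, no `Prop` fact, no `sorry`; axioms standard).
* **`lemma22_sup_noCollar_contour`** — r04's `lemma22_sup_noCollar` with `stairContour hn M` replaced by any `Γ` with
  `hnn` (nearest-neighbour from `baseEmb hn M y`), `hend` (ends at `x` when `x ∈ B(y)`), `hlen` (`|Γ y x| ≤ (d+1)·n`): `∃ C > 0 ∀ (c,β) S ∃ e₁ > 0`
  such that `‖G_k(□,A)Φ‖_∞ ≤ C‖Φ‖_∞` and `‖D^η_{A,μ}G_k(□,A)Φ‖_∞ ≤ C‖Φ‖_∞` for every box `Π[0,nM_μ)` (`1 ≤ M_μ ≤ S`, `nM_μ ≥ 3`), every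
  component field `A` (1.7)-regular on the box and `0 < e ≤ e₁`.
* **`eq220_noCollar_contour`** — r04's `eq220_noCollar` likewise: `‖K_{h_j}G_k(□,A)(h_jΦ)‖_∞ ≤ (C/K)‖Φ‖_∞` for `h_j = hBox n K M j`, any
  label `j`, `K ∣ M_μ`.
HONEST SCOPE.  Exactly r04 g15's scope (sup members `n = 0,1` of (2.17) and (2.20); `d`, `N`, the flow, `L ≥ 2`, the windows `[a₋,a₊]`,
`[0, m²₊]`; the gauge `λ` of `B4BoxNeumannGauge`), for a contour-system PARAMETER; the staircase case is r04's theorem (not re-derived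
here).  Unit `lit-balaban-p35` gen 15 (literature-prover-lit-balaban-p35-g15-0).
-/

namespace Literature.MathematicalPhysics.QuantumFieldTheory.Balaban1983to89.B4Lemma22NoCollarContours

open Finset Matrix
open Literature.MathematicalPhysics.QuantumFieldTheory.Balaban1983to89.B4GaugeCovariance (fld fld_blockOp_mulVec
  OrthFlow fieldLink boxWt blkWt constBond contourTrans pathEnd bondGauge blockDiag IsGauge gaugeKer
  fieldLink_bondGauge b4Green_bondGauge sum_boxWt_right)
open Literature.MathematicalPhysics.QuantumFieldTheory.Balaban1983to89.B4Lower18Regular (e1 e1_apply_self e1_apply_ne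
  pertE crossOp lsum baseEmb PathRel abs_lsum_le)
open Literature.MathematicalPhysics.QuantumFieldTheory.Balaban1983to89.B4Lower18RegularRegion (compField compField_add
  compField_sub)
open Literature.MathematicalPhysics.QuantumFieldTheory.Balaban1983to89.B4Lemma21Region (siteNorm covDeriv)
open Literature.MathematicalPhysics.QuantumFieldTheory.Balaban1983to89.B4Reflection242 (nbrs mem_nbrs boxDom
  mem_boxDom nbrs_comm)
open Literature.MathematicalPhysics.QuantumFieldTheory.Balaban1983to89.B4Lemma22Reduce231
open Literature.MathematicalPhysics.QuantumFieldTheory.Balaban1983to89.B4Lemma22ReduceZero (siteNorm_sum_le Box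
  greenA opA derivA derivA0 sup_hyps_conj covDeriv_gauge)
open Literature.MathematicalPhysics.QuantumFieldTheory.Balaban1983to89.B4Lemma22PertVSup (constBond_antisymm)
open Literature.MathematicalPhysics.QuantumFieldTheory.Balaban1983to89.B4Lemma22Invertible (opA_isUnit_det)
open Literature.MathematicalPhysics.QuantumFieldTheory.Balaban1983to89.B4Commutators25to211 (mulH)
open Literature.MathematicalPhysics.QuantumFieldTheory.Balaban1983to89.B4Eq220PartitionSizes (hBox hsize_hBox)
open Literature.MathematicalPhysics.QuantumFieldTheory.Balaban1983to89.B4Eq220CommutatorField (kOp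
  eq220_field_reduction_sup sizes_Minv_field supN_mulH_le)
open Literature.MathematicalPhysics.QuantumFieldTheory.Balaban1983to89.B4PartitionUnity22 (hprof D1 D2 D1_nonneg
  D2_nonneg contDiff_hprof hasCompactSupport_hprof)
open Literature.MathematicalPhysics.QuantumFieldTheory.Balaban1983to89.B4CubeFieldHyps22 (greenA_smul derivA_smul
  kOp_smul cube_threshold smallness_of_le aSeq_window)
open Literature.MathematicalPhysics.QuantumFieldTheory.Balaban1983to89.B4BoxNeumannGauge (gauged gaugeFn C1 C2)
open Literature.MathematicalPhysics.QuantumFieldTheory.Balaban1983to89.B4Lemma22BoxNoCollar (lemma22_17_sup_box_face gSig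
  gBond bondGauge_gBond gBond_hyps noCollar_threshold)

noncomputable section

variable {ι : Type} [Fintype ι] [DecidableEq ι]

section NoCollar

variable {d : ℕ}

/-- `C₁(d) ≥ 0` (the constant of `B4BoxNeumannGauge`). [cite: Balaban1983RegularityDecay, (1.7) p. 572, dictionary] -/
private theorem C1_nn (d : ℕ) : 0 ≤ C1 d := by unfold C1; positivity

/-- `C₂(d) ≥ 0` (the constant of `B4BoxNeumannGauge`). [cite: Balaban1983RegularityDecay, (1.7) p. 572, dictionary] -/
private theorem C2_nn (d : ℕ) : 0 ≤ C2 d := by unfold C2; positivity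

/-- the zero constant configuration is the zero bond function on the fine box.
[cite: Balaban1983RegularityDecay, p. 581 «constant configurations A₀», dictionary] -/
private theorem constBond_zero_box {X : Type*} (pos : X → (Fin (d + 1) → ℤ)) (u v : X) :
    constBond (0 : Fin (d + 1) → ℝ) pos u v = 0 := by
  simp [constBond]

/-- **THE CONTOUR HYPOTHESIS `τ` FOR A GENERAL NEAREST-NEIGHBOUR SYSTEM OF LENGTH `≤ (d+1)·n`**: `|κA′(Γ_{y,x})| ≤ (d+1)θ` when
`|κA′_b| ≤ θ/n` on nearest-neighbour bonds. [cite: Balaban1983RegularityDecay, (1.4) p. 572; Lemma 2.2 p. 578] -/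
theorem contour_lsum_le (κ : ℝ) {n : ℕ} (hn : 1 ≤ n) (M : Fin (d + 1) → ℕ)
    {emb : ↥(boxDom M) → ↥(boxDom (fun i => n * M i))}
    {Γ : ↥(boxDom M) → ↥(boxDom (fun i => n * M i)) → List ↥(boxDom (fun i => n * M i))}
    (hnn : ∀ y x, PathRel (fun u v : ↥(boxDom (fun i => n * M i)) => v.1 ∈ nbrs u.1) (emb y) (Γ y x))
    (hlen : ∀ y x, ((Γ y x).length : ℝ) ≤ ((d : ℝ) + 1) * n)
    {A' : ↥(boxDom (fun i => n * M i)) → ↥(boxDom (fun i => n * M i)) → ℝ} {θ : ℝ} (hθ : 0 ≤ θ)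
    (hA' : ∀ x y : ↥(boxDom (fun i => n * M i)), y.1 ∈ nbrs x.1 → |κ * A' x y| ≤ θ / n)
    (y : ↥(boxDom M)) (x : ↥(boxDom (fun i => n * M i))) :
    |κ * lsum A' (emb y) (Γ y x)| ≤ ((d : ℝ) + 1) * θ := by
  have h := abs_lsum_le (r := fun u v : ↥(boxDom (fun i => n * M i)) => v.1 ∈ nbrs u.1) (κ := κ) (B := A')
    (ρ := θ / n) (fun u v huv => hA' u v huv) (emb y) (Γ y x) (hnn y x)
  have hn' : (0 : ℝ) < n := by exact_mod_cast hn
  calc |κ * lsum A' (emb y) (Γ y x)|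
      ≤ ((Γ y x).length : ℝ) * (θ / n) := h
    _ ≤ ((d : ℝ) + 1) * n * (θ / n) := mul_le_mul_of_nonneg_right (hlen y x) (div_nonneg hθ hn'.le)
    _ = ((d : ℝ) + 1) * θ := by field_simp

/-- **LEMMA 2.2 (2.17), SUP MEMBERS `n = 0, 1`, FOR `G_k(□, A)` AT THE FIELD `A` ITSELF, (1.7)-REGULAR ON THE BOX, WITH NO COLLAR, FOR A
GENERAL CONTOUR SYSTEM** (the print's boundary-cube choice «Ã_j = A», p. 575, on a parallelepiped, p. 579; the averaging (1.4) along any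
nearest-neighbour contours `Γ^{(k)}_{y,x}` from the block corner `n·y` to `x ∈ B(y)` of length `≤ (d+1)n` — e.g. the composite contour (2.2)
of [Balaban1982Higgs1]): there is `C > 0` (from Lemma 2.2 at charge `1`: `d`, `N`, the flow, `L`, the windows) such that for every regularity
pair `(c, β)`, `β > 0`, and side bound `S` there is `e₁ > 0` with: for every mesh `n = L^k`, `k ≥ 1`, every `a, m²` of the windows, every box
`□ = Π_μ[0, nM_μ)` with `1 ≤ M_μ ≤ S` and `nM_μ ≥ 3`, every such contour system, EVERY component field `A` with `|A_ν(x + e_μ) − A_ν(x)| ≤ ce^{β−1}/n`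
for `x ∈ □` (the printed (1.7), nothing at the boundary) and every charge `0 < e ≤ e₁`: `‖G_k(□,A)Φ‖_∞ ≤ C‖Φ‖_∞` and
`‖D^η_{A,μ}G_k(□,A)Φ‖_∞ ≤ C‖Φ‖_∞` for every `μ` (coupling `e/n`, corner embedding).  Proof: r04's `lemma22_17_sup_box_face` at `A₀ = 0`,
`A′ = (e/n)A″` (`gBond_hyps`), invertibility by `opA_isUnit_det`, `τ = (d+1)θ` by `contour_lsum_le`, then the gauge step `A = (A″)^λ`.
[cite: Balaban1983RegularityDecay, Lemma 2.2 (2.17) p. 578 with p. 579 «we can apply Lemma 2.2 to all operators in it», (1.4) p. 572 and (1.7) p. 572] -/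
theorem lemma22_sup_noCollar_contour (F : OrthFlow ι) {ℓ₁ : ℝ} (hℓ₁ : 0 ≤ ℓ₁)
    (hLip : ∀ t (v : ι → ℝ), ((F.U t - 1) *ᵥ v) ⬝ᵥ ((F.U t - 1) *ᵥ v) ≤ (ℓ₁ * t) ^ 2 * (v ⬝ᵥ v))
    (d ℓ : ℕ) (hℓ : 1 ≤ ℓ) (amin aplus m2plus : ℝ) (ha : 0 < amin) :
    ∃ C : ℝ, 0 < C ∧ ∀ (creg β : ℝ), 0 ≤ creg → 0 < β → ∀ (S : ℕ),
      ∃ e₁ : ℝ, 0 < e₁ ∧ ∀ (k : ℕ), 1 ≤ k → ∀ (hn : 1 ≤ (ℓ + 1) ^ k) (a m2 : ℝ),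
      amin ≤ a → a ≤ aplus → 0 ≤ m2 → m2 ≤ m2plus →
      ∀ (M : Fin (d + 1) → ℕ), (∀ i, 1 ≤ M i) → (∀ i, M i ≤ S) → (∀ i, 3 ≤ (ℓ + 1) ^ k * M i) →
      ∀ (Γ : ↥(boxDom M) → ↥(Box d ℓ k M) → List ↥(Box d ℓ k M)),
        (∀ y x, PathRel (fun u v : ↥(Box d ℓ k M) => v.1 ∈ nbrs u.1) (baseEmb hn M y) (Γ y x)) →
        (∀ y x, blkWt ((ℓ + 1) ^ k) M (fun i => (ℓ + 1) ^ k * M i) y x ≠ 0 → pathEnd (baseEmb hn M y) (Γ y x) = x) →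
        (∀ y x, ((Γ y x).length : ℝ) ≤ ((d : ℝ) + 1) * (((ℓ + 1) ^ k : ℕ) : ℝ)) →
      ∀ (Ac : (Fin (d + 1) → ℤ) → Fin (d + 1) → ℝ) (e : ℝ), 0 < e → e ≤ e₁ →
        (∀ x ∈ Box d ℓ k M, ∀ μ ν : Fin (d + 1),
          |Ac (x + e1 μ) ν - Ac x ν| ≤ creg * e ^ (β - 1) / ((ℓ + 1) ^ k : ℕ)) →
      ∀ Φ : ↥(Box d ℓ k M) × ι → ℝ,
        supN (greenA d F (e / ((ℓ + 1) ^ k : ℕ)) ℓ k a m2 M (baseEmb hn M) Γ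
            (fun u v => compField Ac u.1 v.1) *ᵥ Φ) ≤ C * supN Φ ∧
        ∀ μ : Fin (d + 1),
          supN (derivA d F (e / ((ℓ + 1) ^ k : ℕ)) ℓ k M (fun u v => compField Ac u.1 v.1) μ
              *ᵥ (greenA d F (e / ((ℓ + 1) ^ k : ℕ)) ℓ k a m2 M (baseEmb hn M) Γ
                  (fun u v => compField Ac u.1 v.1) *ᵥ Φ)) ≤ C * supN Φ := by
  obtain ⟨c, hc, hL⟩ := lemma22_17_sup_box_face F hℓ₁ hLip 1 d ℓ hℓ amin aplus m2plus ha
  set C : ℝ := (1 + ℓ₁) * (2 * (((d : ℝ) + 2) * c)) with hC_def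
  have hC0 : 0 < C := by rw [hC_def]; positivity
  refine ⟨C, hC0, fun creg β hcreg hβ S => ?_⟩
  obtain ⟨e₁, he₁, hth⟩ := noCollar_threshold d (c := c) (aplus := aplus) hℓ₁ hc.le ha hcreg hβ S
  refine ⟨e₁, he₁, ?_⟩
  intro k hk hn a m2 e1' e2 e3 e4 M hM hS hN3 Γ hnn hend hlen Ac e he hle h17 Φ
  obtain ⟨hak1, hak2⟩ := aSeq_window hℓ hk ha e1' e2
  obtain ⟨hθ1, -, hsm⟩ := hth e he hle _ hak1 hak2
  obtain ⟨-, hA', hder, hface⟩ := gBond_hyps (d := d) hn hS hN3 hcreg he h17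
  set n : ℕ := (ℓ + 1) ^ k with hn_def
  set A' : ↥(Box d ℓ k M) → ↥(Box d ℓ k M) → ℝ := gBond (e / n) (fun i => n * M i) Ac with hA'_def
  have hpow : 0 < e ^ β := Real.rpow_pos_of_pos he β
  have hC1n := C1_nn d
  have hC2n := C2_nn d
  have hθ0 : 0 ≤ (C2 d + S * C1 d) * creg * e ^ β := by positivity
  have hθ'0 : 0 ≤ C1 d * creg * e ^ β := by positivity
  have hθf0 : 0 ≤ C2 d * creg * e ^ β := by positivity
  have hτ0 : 0 ≤ ((d : ℝ) + 1) * ((C2 d + S * C1 d) * creg * e ^ β) := by positivity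
  have ha' : 0 < a := lt_of_lt_of_le ha e1'
  -- invertibility for ANY contour system with `hnn`/`hend` (r01), and the contour bound `τ = (d+1)θ`
  have hunit : IsUnit (opA d F 1 ℓ k a m2 M (baseEmb hn M) Γ
      (constBond (0 : Fin (d + 1) → ℝ) Subtype.val + A')).det :=
    opA_isUnit_det F 1 hℓ hk ha' e3 M (fun y x _ => hnn y x) hend _
  have hτ : ∀ y x, blkWt n M (fun i => n * M i) y x ≠ 0 →
      |1 * lsum A' (baseEmb hn M y) (Γ y x)| ≤ ((d : ℝ) + 1) * ((C2 d + S * C1 d) * creg * e ^ β) :=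
    fun y x _ => contour_lsum_le 1 hn M hnn hlen hθ0 hA' y x
  have hmem := hL k hk a m2 e1' e2 e3 e4 M hM (baseEmb hn M) Γ hend 0 A' _ _ _ _ hunit hθ0 hA' hθ'0 hder hθf0
    hface hτ0 hτ hsm
  rw [show (constBond (0 : Fin (d + 1) → ℝ) Subtype.val + A' : ↥(Box d ℓ k M) → ↥(Box d ℓ k M) → ℝ) = A' from by
    funext u v; rw [Pi.add_apply, Pi.add_apply, constBond_zero_box, zero_add]] at hmem
  -- both members with the common constant `C`, at charge `1` for `A'`
  have hc2 : 0 ≤ 2 * (((d : ℝ) + 2) * c) := by positivity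
  have hCa : 2 * (((d : ℝ) + 2) * c) ≤ C := by rw [hC_def]; nlinarith
  have hCb : (1 + ℓ₁ * ((C2 d + S * C1 d) * creg * e ^ β)) * (2 * (((d : ℝ) + 2) * c)) ≤ C := by
    rw [hC_def]
    refine mul_le_mul_of_nonneg_right ?_ hc2
    have : ℓ₁ * ((C2 d + S * C1 d) * creg * e ^ β) ≤ ℓ₁ * 1 := mul_le_mul_of_nonneg_left hθ1 hℓ₁
    linarith
  have hG : ∀ Ψ, supN (greenA d F 1 ℓ k a m2 M (baseEmb hn M) Γ A' *ᵥ Ψ) ≤ C * supN Ψ := by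
    intro Ψ
    have h1 := (hmem Ψ).1
    have hsum : 0 ≤ ∑ μ, supN (derivA0 d F 1 ℓ k M 0 μ
        *ᵥ (greenA d F 1 ℓ k a m2 M (baseEmb hn M) Γ A' *ᵥ Ψ)) :=
      Finset.sum_nonneg fun μ _ => supN_nonneg _
    exact ((le_add_of_nonneg_right hsum).trans h1).trans (mul_le_mul_of_nonneg_right hCa (supN_nonneg Ψ))
  have hD : ∀ (μ : Fin (d + 1)) Ψ, supN (derivA d F 1 ℓ k M A' μ
      *ᵥ (greenA d F 1 ℓ k a m2 M (baseEmb hn M) Γ A' *ᵥ Ψ)) ≤ C * supN Ψ :=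
    fun μ Ψ => ((hmem Ψ).2 μ).trans (mul_le_mul_of_nonneg_right hCb (supN_nonneg Ψ))
  -- the gauge step: `(e/n)A = (A')^{σ}`, `σ = (e/n)λ`
  have hgauge := sup_hyps_conj
    (F.isGauge (fun u : ↥(Box d ℓ k M) => 1 * gSig (e / n) (fun i => n * M i) Ac u)) hG hD
  have hend' : ∀ y x, blkWt n M (fun i => n * M i) y x ≠ 0 → pathEnd (baseEmb hn M y) (Γ y x) = x := hend
  have hfield : (fun u v : ↥(Box d ℓ k M) => e / n * compField Ac u.1 v.1)
      = bondGauge (gSig (e / n) (fun i => n * M i) Ac) A' :=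
    (bondGauge_gBond (e / n) (fun i => n * M i) Ac).symm
  have hGeq : greenA d F (e / n) ℓ k a m2 M (baseEmb hn M) Γ (fun u v => compField Ac u.1 v.1)
      = blockDiag (fun u => F.U (1 * gSig (e / n) (fun i => n * M i) Ac u))
          * greenA d F 1 ℓ k a m2 M (baseEmb hn M) Γ A'
          * (blockDiag fun u => F.U (1 * gSig (e / n) (fun i => n * M i) Ac u))ᵀ := by
    rw [greenA_smul, hfield]
    dsimp only [greenA]
    rw [b4Green_bondGauge F 1 _ m2 _ hend']
  have hDeq : ∀ μ, derivA d F (e / n) ℓ k M (fun u v => compField Ac u.1 v.1) μ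
      = blockDiag (fun u => F.U (1 * gSig (e / n) (fun i => n * M i) Ac u))
          * derivA d F 1 ℓ k M A' μ
          * (blockDiag fun u => F.U (1 * gSig (e / n) (fun i => n * M i) Ac u))ᵀ := by
    intro μ
    rw [derivA_smul, hfield]
    dsimp only [derivA]
    rw [fieldLink_bondGauge, covDeriv_gauge (F.isGauge _)]
  refine ⟨?_, fun μ => ?_⟩
  · rw [hGeq]; exact hgauge.1 Φ
  · rw [hGeq, hDeq μ]; exact hgauge.2 μ Φ

/-- **(2.20) «‖K_jG_k(□_j,Ã_j)h_j‖_∞ ≤ c₂O(1)M⁻¹» AT `Ã_j = A` FOR A (1.7)-REGULAR `A` WITH NO COLLAR, ANY LABEL `j`, FOR A GENERAL CONTOUR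
SYSTEM** (face labels of a parallelepiped included): there is `C > 0` such that for every `(c, β)`, `β > 0`, side bound `S` and large-cube
size `K ≥ 1` there is `e₁ > 0` with: for every mesh `n = L^k` (`nK ≥ 3`), `a, m²` of the windows, box `□ = Π_μ[0, nM_μ)` (`1 ≤ M_μ ≤ S`,
`K ∣ M_μ`), every nearest-neighbour contour system from the block corners of length `≤ (d+1)n`, EVERY label `j`, every (1.7)-regular `A`
on `□` and `0 < e ≤ e₁`: `‖K_{h_j}G_k(□,A)(h_jΦ)‖_∞ ≤ (C/K)‖Φ‖_∞`, `h_j = hBox n K M j` — `lemma22_sup_noCollar_contour` fed to p35's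
reduction `eq220_field_reduction_sup` with the sizes `hsize_hBox` (r04's `eq220_noCollar`, contour system as a parameter).
[cite: Balaban1983RegularityDecay, (2.20) p. 578 «c₂O(1)M⁻¹» with p. 579 «we can apply Lemma 2.2 to all operators in it», (1.4) p. 572 and (1.7) p. 572] -/
theorem eq220_noCollar_contour (F : OrthFlow ι) {ℓ₁ : ℝ} (hℓ₁ : 0 ≤ ℓ₁)
    (hLip : ∀ t (v : ι → ℝ), ((F.U t - 1) *ᵥ v) ⬝ᵥ ((F.U t - 1) *ᵥ v) ≤ (ℓ₁ * t) ^ 2 * (v ⬝ᵥ v))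
    (d ℓ : ℕ) (hℓ : 1 ≤ ℓ) (amin aplus m2plus : ℝ) (ha : 0 < amin) :
    ∃ C : ℝ, 0 < C ∧ ∀ (creg β : ℝ), 0 ≤ creg → 0 < β → ∀ (S K : ℕ), 1 ≤ K →
      ∃ e₁ : ℝ, 0 < e₁ ∧ ∀ (k : ℕ), 1 ≤ k → ∀ (hn : 1 ≤ (ℓ + 1) ^ k), 3 ≤ (ℓ + 1) ^ k * K →
      ∀ (a m2 : ℝ), amin ≤ a → a ≤ aplus → 0 ≤ m2 → m2 ≤ m2plus →
      ∀ (M : Fin (d + 1) → ℕ), (∀ i, 1 ≤ M i) → (∀ i, M i ≤ S) → (∀ μ, K ∣ M μ) →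
      ∀ (Γ : ↥(boxDom M) → ↥(Box d ℓ k M) → List ↥(Box d ℓ k M)),
        (∀ y x, PathRel (fun u v : ↥(Box d ℓ k M) => v.1 ∈ nbrs u.1) (baseEmb hn M y) (Γ y x)) →
        (∀ y x, blkWt ((ℓ + 1) ^ k) M (fun i => (ℓ + 1) ^ k * M i) y x ≠ 0 → pathEnd (baseEmb hn M y) (Γ y x) = x) →
        (∀ y x, ((Γ y x).length : ℝ) ≤ ((d : ℝ) + 1) * (((ℓ + 1) ^ k : ℕ) : ℝ)) →
      ∀ (j : Fin (d + 1) → ℤ) (Ac : (Fin (d + 1) → ℤ) → Fin (d + 1) → ℝ) (e : ℝ), 0 < e → e ≤ e₁ →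
        (∀ x ∈ Box d ℓ k M, ∀ μ ν : Fin (d + 1),
          |Ac (x + e1 μ) ν - Ac x ν| ≤ creg * e ^ (β - 1) / ((ℓ + 1) ^ k : ℕ)) →
      ∀ Φ : ↥(Box d ℓ k M) × ι → ℝ,
        supN (kOp F (e / ((ℓ + 1) ^ k : ℕ)) ((ℓ + 1) ^ k) (B1.aSeq a ((ℓ : ℝ) + 1) k) m2 M (baseEmb hn M)
              Γ (fun u v => compField Ac u.1 v.1) (hBox ((ℓ + 1) ^ k) K M j)
            *ᵥ (greenA d F (e / ((ℓ + 1) ^ k : ℕ)) ℓ k a m2 M (baseEmb hn M) Γ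
                (fun u v => compField Ac u.1 v.1)
                *ᵥ (mulH (ι := ι) (hBox ((ℓ + 1) ^ k) K M j) *ᵥ Φ)))
          ≤ C / K * supN Φ := by
  obtain ⟨C₀, hC₀, hL⟩ := lemma22_sup_noCollar_contour F hℓ₁ hLip d ℓ hℓ amin aplus m2plus ha
  set s : ℝ := ((d : ℝ) + 1) * (D1 hprof + D2 hprof) with hs_def
  have hs : 0 ≤ s := by
    have := D1_nonneg contDiff_hprof hasCompactSupport_hprof
    have := D2_nonneg contDiff_hprof hasCompactSupport_hprof
    rw [hs_def]; positivity
  set C : ℝ := (2 * ((d : ℝ) + 1) + 1 + |aplus|) * (s + 1) * C₀ with hC_def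
  have hC : 0 < C := by rw [hC_def]; positivity
  refine ⟨C, hC, fun creg β hcreg hβ S K hK1 => ?_⟩
  obtain ⟨e₁, he₁, hth⟩ := hL creg β hcreg hβ S
  refine ⟨e₁, he₁, ?_⟩
  intro k hk hn hnK a m2 e1' e2 e3 e4 M hM hS hKM Γ hnn hend hlen j Ac e he hle h17 Φ
  have hN3 : ∀ i, 3 ≤ (ℓ + 1) ^ k * M i := fun i =>
    hnK.trans (Nat.mul_le_mul_left _ (Nat.le_of_dvd (hM i) (hKM i)))
  have hmem := hth k hk hn a m2 e1' e2 e3 e4 M hM hS hN3 Γ hnn hend hlen Ac e he hle h17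
  obtain ⟨hak1, hak2⟩ := aSeq_window hℓ hk ha e1' e2
  have hak0 : 0 ≤ B1.aSeq a ((ℓ : ℝ) + 1) k := by linarith
  have hanti : ∀ x y : ↥(Box d ℓ k M), (fun u v : ↥(Box d ℓ k M) => compField Ac u.1 v.1) y x
      = -(fun u v : ↥(Box d ℓ k M) => compField Ac u.1 v.1) x y := by
    intro x y
    show compField Ac y.1 x.1 = -compField Ac x.1 y.1
    unfold compField
    ring
  have hh := hsize_hBox hn hK1 hnK hKM j
  have hred := eq220_field_reduction_sup (ν := supN) F (e / ((ℓ + 1) ^ k : ℕ)) (B1.aSeq a ((ℓ : ℝ) + 1) k) m2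
    M (baseEmb hn M) Γ (fun u v : ↥(Box d ℓ k M) => compField Ac u.1 v.1) hn hanti hak0
    hC₀.le hC₀.le
    (greenA d F (e / ((ℓ + 1) ^ k : ℕ)) ℓ k a m2 M (baseEmb hn M) Γ
      (fun u v => compField Ac u.1 v.1))
    (fun Ψ => (hmem Ψ).1) (fun μ Ψ => (hmem Ψ).2 μ) hh Φ (supN_mulH_le hh.abs_le Φ)
  refine hred.trans ?_
  have hKr : (1 : ℝ) ≤ K := by exact_mod_cast hK1
  have hKpos : (0 : ℝ) < K := by linarith
  have har := sizes_Minv_field d 1 (B1.aSeq a ((ℓ : ℝ) + 1) k) hKr hs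
  have hd0 : (0 : ℝ) ≤ d := Nat.cast_nonneg d
  have hX0 : 0 ≤ 2 * ((d : ℝ) + 1) * 1 + 1 + B1.aSeq a ((ℓ : ℝ) + 1) k := by linarith
  have hX1 : 2 * ((d : ℝ) + 1) * 1 + 1 + B1.aSeq a ((ℓ : ℝ) + 1) k ≤ 2 * ((d : ℝ) + 1) + 1 + |aplus| := by
    have := le_abs_self aplus; linarith
  calc (2 * ((d : ℝ) + 1) * (s / K) * C₀ + (s / (K : ℝ) ^ 2 + B1.aSeq a ((ℓ : ℝ) + 1) k * (s / K)) * C₀)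
        * supN Φ
      = (2 * ((d : ℝ) + 1) * 1 * (s / K) + s / (K : ℝ) ^ 2 + B1.aSeq a ((ℓ : ℝ) + 1) k * (s / K))
          * C₀ * supN Φ := by ring
    _ ≤ ((2 * ((d : ℝ) + 1) * 1 + 1 + B1.aSeq a ((ℓ : ℝ) + 1) k) * s / K) * C₀ * supN Φ :=
        mul_le_mul_of_nonneg_right (mul_le_mul_of_nonneg_right har hC₀.le) (supN_nonneg Φ)
    _ = ((2 * ((d : ℝ) + 1) * 1 + 1 + B1.aSeq a ((ℓ : ℝ) + 1) k) * s * C₀) / K * supN Φ := by ring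
    _ ≤ C / K * supN Φ := by
        refine mul_le_mul_of_nonneg_right (div_le_div_of_nonneg_right ?_ hKpos.le) (supN_nonneg Φ)
        rw [hC_def]
        exact mul_le_mul_of_nonneg_right (mul_le_mul hX1 (by linarith) hs (by positivity)) hC₀.le

end NoCollar

end

end Literature.MathematicalPhysics.QuantumFieldTheory.Balaban1983to89.B4Lemma22NoCollarContours
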